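import Summits.KontsevichZagierPeriods.Zeta5Search.Denom.TwoTaleL720Inclusion
import Summits.KontsevichZagierPeriods.Zeta5Search.Denom.TwoTaleL720SavingEncC
import Summits.KontsevichZagierPeriods.Zeta5Search.TwoTaleL720Decay
import Summits.KontsevichZagierPeriods.Zeta5Search.TwoTaleL720GrowthEnclosure
import Summits.KontsevichZagierPeriods.Zeta5Search.TwoTaleD1Measure
import HarnessLib

/-!
# RUNG L(7/20): the irrationality exponent of `ζ(2) = π²/6` is at most `5.0194` — the two-tale ladder's optimal constant to 4 decimals

HONEST FRAMING: systematic search; no irrationality claim unless certified.  This file asserts nothing about `ζ(5)`.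
It draws together, with NO hypothesis, four tree theorems of the L(7/20) programme of cell pub-zeta5 (measure-opt g0; rung
`s = 7/20` of fam-measure g8's two-tale ladder `L(s)`, whose MODEL infimum over all `s` is `5.019370` (`rung_cost.log`,
near `s = 22/63`), so that this rung — model `5.01939129` — realises the ladder's optimal constant to four decimals; the earlier
rungs are D1 = L(1/3), `TwoTaleD1Measure.zetaTwo_exponent_le_D1 : ExponentLE (zetaValue 2) 5.0205`, and L(2/5),
`TwoTaleL25Measure`, `5.01982`).  Two-tale point `a = (127n+1, 107n+1, 87n+1, 147n+1)`, `b = (1, 20n+1, 40n+1, 254n+2)` of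
[Zudilin 2014, §3] = `Lad(20n, 7n)` with its Remark-5 partner:

* `Denom.TwoTaleL720Inclusion.zetaTwo_exponent_le_L720` — the rung theorem with the inclusion DISCHARGED (Lemma 7 / Lemma 8
  digit cells, 783 of them in four kernel-checked cover pieces, transported by `TwoTaleOmega.OmegaLadder.bmiss_Lad`; normaliser
  `D₁₄₇ₙ D₁₅₄ₙ`; the generic `exponentLE_of_normalisedForms`), taking the saving enclosure as a hypothesis;
* the saving enclosure `Denom.TwoTaleL720Saving.savingRate720_bounds : 155.35326 ≤ S ≤ 155.35341` (232 intervals, 39 chunks);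
* the tale-1 DECAY `TwoTaleL720Line.decayL720_holds_sharp : DecayL720 283.1134` (line `x = ⌊251n/5⌋`, two-point kernel
  certificate `≤ −283.11347`);
* the coefficient GROWTH `TwoTaleL720Growth.coeffRateL720_holds : CoeffRateL720 C₁starL720`, `C₁starL720_pos` and the kernel
  enclosure `C₁starL720_le : C₁starL720 ≤ 406.88613`.

RESULT: `zetaTwo_exponent_le_L720 : ExponentLE (zetaValue 2) 5.0194`, restated in Mathlib terms only as
`pi_sq_div_six_not_liouvilleWith_L720 : ∀ p > 5.0194, ¬ LiouvilleWith p (π²/6)`, `pi_sq_not_liouvilleWith_L720` and (over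
Mathlib's `riemannZeta`) `riemannZeta_two_re_not_liouvilleWith_L720`.  Kernel
arithmetic: `1 + (406.88613 + 301 − 155.35326)/(283.1134 − 301 + 155.35326) = 5.019396 ≤ 5.0194` (design `5.01939129`).
`zetaTwo_exponent_le_L720_and_D1` records `5.0194 < 5.0205` next to the D1 theorem.

READING / CAVEATS: a measure bound for the KNOWN-IRRATIONAL number `π²`, not an irrationality proof, with no bearing on `ζ(5)`; below
the tree's D1 bound `5.0205`, the P15 bound `5.0499` and the printed record `5.095412` [Zudilin 2014, Thm 1]
[cite: Zudilin2014ZetaTwo, Theorem 1]; the [Zu14] inputs are the tree's own kernel-checked formalisations; the human-readable proof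
must be written and refereed before prose claims; within THIS ladder no rational rung can give a constant below the model infimum
`5.01937`, so `5.0194` is the ladder's optimal four-decimal constant (further rungs, e.g. `s = 8/23`, `22/63`, move only the fifth
decimal); other families are not addressed.
-/

namespace Summit.KontsevichZagierPeriods.Zeta5Search.TwoTaleL720Measure

open Literature.NumberTheory.Transcendental (zetaValue)

/-- **`μ(ζ(2)) ≤ 5.0194`**: the irrationality exponent of `ζ(2)` is at most `5.0194`, with no hypothesis —
`ExponentLE ξ κ := ∀ p, κ < p → ¬ LiouvilleWith p ξ` (`MeasureRecords`).  Rung L(7/20) of the two-tale ladder (see the module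
docstring); below the tree's rungs `5.0205` (D1), `5.01982` (L(2/5)) and the printed record `5.095412`
[cite: Zudilin2014ZetaTwo, Theorem 1]. -/
theorem zetaTwo_exponent_le_L720 : ExponentLE (zetaValue 2) 5.0194 :=
  Denom.TwoTaleL720Inclusion.zetaTwo_exponent_le_L720 TwoTaleL720Line.decayL720_holds_sharp
    TwoTaleL720Growth.coeffRateL720_holds TwoTaleL720Growth.C₁starL720_pos TwoTaleL720Growth.C₁starL720_le
    Denom.TwoTaleL720Saving.savingRate720_bounds

/-- **`μ(π²/6) ≤ 5.0194` in Mathlib terms only** (junk-value-free restatement): for every real `p > 5.0194`, `π²/6` is not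
Liouville with exponent `p`. [cite: Zudilin2014ZetaTwo, Theorem 1] -/
theorem pi_sq_div_six_not_liouvilleWith_L720 :
    ∀ p : ℝ, (5.0194 : ℝ) < p → ¬ LiouvilleWith p (Real.pi ^ 2 / 6) := by
  intro p hp
  have h2 : zetaValue 2 = Real.pi ^ 2 / 6 := by rw [zetaValue]; exact hasSum_zeta_two.tsum_eq
  rw [← h2]
  exact zetaTwo_exponent_le_L720 p hp

/-- `μ(π²) ≤ 5.0194` as well (`LiouvilleWith` is invariant under multiplication by a nonzero rational, Mathlib
`LiouvilleWith.mul_rat_iff`). -/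
theorem pi_sq_not_liouvilleWith_L720 : ∀ p : ℝ, (5.0194 : ℝ) < p → ¬ LiouvilleWith p (Real.pi ^ 2) := by
  intro p hp h
  refine pi_sq_div_six_not_liouvilleWith_L720 p hp ?_
  have e : Real.pi ^ 2 / 6 = Real.pi ^ 2 * ((1 / 6 : ℚ) : ℝ) := by push_cast; ring
  rw [e, LiouvilleWith.mul_rat_iff (by norm_num)]
  exact h

/-- The ladder in one line: the L(7/20) and D1 rungs are tree theorems and `5.0194 < 5.0205`. -/
theorem zetaTwo_exponent_le_L720_and_D1 :
    ExponentLE (zetaValue 2) 5.0194 ∧ ExponentLE (zetaValue 2) 5.0205 ∧ (5.0194 : ℝ) < 5.0205 :=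
  ⟨zetaTwo_exponent_le_L720, TwoTaleD1Measure.zetaTwo_exponent_le_D1, by norm_num⟩

/-!
## Restatements over Mathlib's `riemannZeta` (same shape as `TwoTaleD1Measure.riemannZeta_two_re_not_liouvilleWith_D1`)

The bound `μ(ζ(2)) ≤ 5.0194` with Mathlib's `riemannZeta` in place of the tree's real series `zetaValue 2`, so that the `ζ(2)`
form of the statement can be checked against Mathlib alone (`riemannZeta`, `Complex.re`, `LiouvilleWith`, numerals).  No new
mathematics: `Literature.NumberTheory.Transcendental.ofReal_zetaValue` (`(zetaValue k : ℂ) = riemannZeta k` for `1 < k`) and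
`Complex.ofReal_re`.  HONEST FRAMING: a measure bound for the known-irrational `ζ(2) = π²/6`; nothing about `ζ(5)`.
-/

open Literature.NumberTheory.Transcendental (ofReal_zetaValue) in
/-- **`μ(ζ(2)) ≤ 5.0194` over Mathlib's `riemannZeta`**: for every real `p > 5.0194`, the real part of `riemannZeta 2`
(the real number `ζ(2) = π²/6`) is not Liouville with exponent `p`. [cite: Zudilin2014ZetaTwo, Theorem 1] -/
theorem riemannZeta_two_re_not_liouvilleWith_L720 :
    ∀ p : ℝ, (5.0194 : ℝ) < p → ¬ LiouvilleWith p (riemannZeta 2).re := by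
  intro p hp
  have h : (riemannZeta 2).re = zetaValue 2 := by
    rw [show (2 : ℂ) = ((2 : ℕ) : ℂ) by norm_num, ← ofReal_zetaValue (by norm_num), Complex.ofReal_re]
  rw [h]
  exact zetaTwo_exponent_le_L720 p hp

/-- The same without `Complex.re`: any real `x` whose complex coercion is `riemannZeta 2` (there is exactly one, `x = π²/6`)
is not Liouville with any exponent `p > 5.0194`. [cite: Zudilin2014ZetaTwo, Theorem 1] -/
theorem not_liouvilleWith_of_ofReal_eq_riemannZeta_two_L720 :
    ∀ p : ℝ, (5.0194 : ℝ) < p → ∀ x : ℝ, (x : ℂ) = riemannZeta 2 → ¬ LiouvilleWith p x := by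
  intro p hp x hx
  have e : x = (riemannZeta 2).re := by rw [← hx, Complex.ofReal_re]
  rw [e]
  exact riemannZeta_two_re_not_liouvilleWith_L720 p hp

/-!
## The literal «finitely many pairs» reading at `5.0194` (append, measure-opt g2, 2026-08-26)

The sentence a reader wants AS STATED — for every `p > 5.0194` and every `C` there are only finitely many pairs
`(m, n) ∈ ℤ × ℕ` with `0 < |π² − m/n| < C / n^p`, and the same for `π²/6 = ζ(2)` — as a `Set.Finite` over `ℤ × ℕ` in the
vocabulary `Real.pi`, `|·|`, `rpow`, numerals, plus the threshold form.  Derived from `pi_sq_not_liouvilleWith_L720` and the generic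
unfolding lemmas of `TwoTaleD1Measure` (`finite_pairs_of_not_liouvilleWith`, `exists_threshold_of_not_liouvilleWith`; measure-writer
g6's D1 append, same shape at `5.0205`).  No new mathematics.  HONEST FRAMING: a measure bound for the known-irrational `π²`;
nothing about `ζ(5)`.
-/

/-- **Finitely many pairs at exponent `5.0194`.**  For every real `p > 5.0194` and every `C`, only finitely many pairs
`(m, n) ∈ ℤ × ℕ` satisfy `0 < |π² − m/n| < C / n^p`.  From `pi_sq_not_liouvilleWith_L720` and Mathlib's definition of
`LiouvilleWith` alone (via `TwoTaleD1Measure.finite_pairs_of_not_liouvilleWith`). [cite: Zudilin2014ZetaTwo, Theorem 1] -/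
theorem pi_sq_finitely_many_approximations_L720 (p : ℝ) (hp : (5.0194 : ℝ) < p) (C : ℝ) :
    Set.Finite {q : ℤ × ℕ | 0 < |Real.pi ^ 2 - (q.1 : ℝ) / q.2| ∧ |Real.pi ^ 2 - (q.1 : ℝ) / q.2| < C / (q.2 : ℝ) ^ p} :=
  TwoTaleD1Measure.finite_pairs_of_not_liouvilleWith (by linarith) (pi_sq_not_liouvilleWith_L720 p hp) C

/-- The same for `π²/6 = ζ(2)` at exponent `5.0194`. -/
theorem pi_sq_div_six_finitely_many_approximations_L720 (p : ℝ) (hp : (5.0194 : ℝ) < p) (C : ℝ) :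
    Set.Finite {q : ℤ × ℕ | 0 < |Real.pi ^ 2 / 6 - (q.1 : ℝ) / q.2| ∧
      |Real.pi ^ 2 / 6 - (q.1 : ℝ) / q.2| < C / (q.2 : ℝ) ^ p} :=
  TwoTaleD1Measure.finite_pairs_of_not_liouvilleWith (by linarith) (pi_sq_div_six_not_liouvilleWith_L720 p hp) C

/-- **Threshold form at `5.0194`**: for `p > 5.0194` and every `C` there is `N` with `π² = m/n ∨ C/n^p ≤ |π² − m/n|` for all
`n ≥ N`, `m ∈ ℤ`. -/
theorem pi_sq_approximation_threshold_L720 (p : ℝ) (hp : (5.0194 : ℝ) < p) (C : ℝ) :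
    ∃ N : ℕ, ∀ n : ℕ, N ≤ n → ∀ m : ℤ, Real.pi ^ 2 = (m : ℝ) / n ∨ C / (n : ℝ) ^ p ≤ |Real.pi ^ 2 - (m : ℝ) / n| := by
  obtain ⟨N, hN⟩ := TwoTaleD1Measure.exists_threshold_of_not_liouvilleWith (pi_sq_not_liouvilleWith_L720 p hp) C
  exact ⟨N, fun n hn m => (em _).imp_right (hN n hn m)⟩

/-- The same threshold form over Mathlib's `riemannZeta`: for `p > 5.0194` and every `C` there is `N` with
`(riemannZeta 2).re = m/n ∨ C/n^p ≤ |(riemannZeta 2).re − m/n|` for all `n ≥ N`, `m ∈ ℤ`. -/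
theorem riemannZeta_two_re_approximation_threshold_L720 (p : ℝ) (hp : (5.0194 : ℝ) < p) (C : ℝ) :
    ∃ N : ℕ, ∀ n : ℕ, N ≤ n → ∀ m : ℤ,
      (riemannZeta 2).re = (m : ℝ) / n ∨ C / (n : ℝ) ^ p ≤ |(riemannZeta 2).re - (m : ℝ) / n| := by
  obtain ⟨N, hN⟩ :=
    TwoTaleD1Measure.exists_threshold_of_not_liouvilleWith (riemannZeta_two_re_not_liouvilleWith_L720 p hp) C
  exact ⟨N, fun n hn m => (em _).imp_right (hN n hn m)⟩

end Summit.KontsevichZagierPeriods.Zeta5Search.TwoTaleL720Measure
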